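import Summits.Ventures.CertifiedManyBodySolver.Theorems.M3x2EdgeSplitSymReplayDecode

/-!
# SymReplay checker — certificate TEXT DECODER, token grammar v2 «ENC-2» (additive; authored by hub-lb-dual-eng-3 g2 —
`Cruxes/LowerEdge_ge_m83o100/SymReplayDecodeV2_dualeng3.lean` 9e33f0a68a49, landed verbatim by hub-lb-sym-eng-4 g1; crit-1 V99 (B) / V100)

Same idea and same trust model as `…SymReplayDecode` (v1: `decodeSymCert ∘ toks`): certificate data ships as `String`
literals of whitespace-separated decimal integers and is decoded at evaluation time; soundness is untouched (every
theorem goes through `symCheck`; a malformed string can only make the checker fail).  Grammar v2 is a DENSER encoding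
of the SAME `SymCert` (test: `symCertEqB (decodeSymCert v1) (decodeSymCertV2 v2) = true` by `native_decide`):
* (G1′) a ladder LETTER is ONE token `code = 4·i + 2·s + dag`, `i` = index of its site in the shipped `frame` list
  (the decoder builds the site table once); a word is `n codeⁿ` (v1: `n (x y s dag)ⁿ`, ≈ 10 B/letter ↦ ≤ 5 B);
* (G2) every rational-bearing slot carries ONE shared denominator `D` (first token of the slot / of a Gram block's
  basis) and ships NUMERATORS only: `poly = n (p word)ⁿ` read as `Σ (p/D)·word`.
Token grammar v2 (all integers; counts prefix their lists; `D ≤ 0` is read as `1`):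
`frame: n (x y)ⁿ · inner: n (x y)ⁿ · mu: p q · c: p q · useCanon: 0|1 · gramM: n blockⁿ · eom: D n polyⁿ · wardP: D n polyⁿ ·
wardM: D n polyⁿ · antiH: D D' n (p poly)ⁿ · slack: D n (p word)ⁿ · charged: D n (p word)ⁿ`, with
`block: p q D nB polyⁿᴮ nR rowⁿᴿ`, `row: n (ℓ δ)ⁿ` with DELTA-coded ascending columns `k_j = k_{j−1} + 1 + δ_j`
(`k_0 = δ_0`; (G4): dense low-rank rows cost one digit per index), `poly: n (p word)ⁿ`, `word: n codeⁿ`;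
in `antiH` the outer weights are `/ D` and the inner polynomial coefficients `/ D'`.
Under `fillCert` (T13′/T14′, `SymReplayFill`) the `antiH`/`slack` slots are shipped EMPTY (`D 0` ↦ `1 0`).
Also here: `symCertEqB`, a structural Boolean equality of certificates (sites by `siteEq`, words by `wordEq`,
rationals by `decide`), for the v1 = v2 round-trip test.  No summit statement is proved here; nothing here predicts
superconductivity.
-/

namespace Summit.Ventures.CertifiedManyBodySolver.Theorems.SymReplay

open Literature.Probability.LatticeModels (Site)

section DecodeV2

/-- The frame's site table (pairs of integers, indexable). -/
def siteTab (frame : List (Site 2)) : Array (ℤ × ℤ) := (frame.map fun x => (x 0, x 1)).toArray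

/-- Decode one letter code `4·i + 2·s + dag` against the site table (junk site `(0,0)` if `i` is out of range —
soundness-neutral, the checker then judges the decoded certificate). -/
def decLetter (tab : Array (ℤ × ℤ)) (c : ℤ) : Letter :=
  let n := c.toNat
  let p := tab.getD (n / 4) (0, 0)
  ⟨mkSite p.1 p.2, if (n / 2) % 2 == 1 then 1 else 0, n % 2 == 1⟩

/-- Read `n` letter codes. -/
def rdCodes (tab : Array (ℤ × ℤ)) : ℕ → Toks → Word × Toks
  | 0, ts => ([], ts)
  | n + 1, c :: ts => let r := rdCodes tab n ts; (decLetter tab c :: r.1, r.2)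
  | _ + 1, [] => ([], [])

/-- Read a word `n codeⁿ`. -/
def rdWordC (tab : Array (ℤ × ℤ)) (ts : Toks) : Word × Toks := let c := rdNat ts; rdCodes tab c.1 c.2

/-- Read a slot / block denominator (one integer; `≤ 0` ↦ `1`). -/
def rdDen : Toks → ℚ × Toks
  | d :: ts => (if d ≤ 0 then 1 else (d : ℚ), ts)
  | [] => (1, [])

/-- Read `n` terms `(p word)` with coefficients `p / D`. -/
def rdTermsD (tab : Array (ℤ × ℤ)) (D : ℚ) : ℕ → Toks → QPoly × Toks
  | 0, ts => ([], ts)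
  | n + 1, p :: ts =>
    let w := rdWordC tab ts
    let r := rdTermsD tab D n w.2
    (((p : ℚ) / D, w.1) :: r.1, r.2)
  | _ + 1, [] => ([], [])

/-- Read a polynomial `n (p word)ⁿ` over the denominator `D`. -/
def rdPolyD (tab : Array (ℤ × ℤ)) (D : ℚ) (ts : Toks) : QPoly × Toks := let c := rdNat ts; rdTermsD tab D c.1 c.2

/-- Read `n` polynomials over `D`. -/
def rdPolysD (tab : Array (ℤ × ℤ)) (D : ℚ) : ℕ → Toks → List QPoly × Toks
  | 0, ts => ([], ts)
  | n + 1, ts => let p := rdPolyD tab D ts; let r := rdPolysD tab D n p.2; (p.1 :: r.1, r.2)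

/-- Read `n` row entries `(ℓ δ)` with delta-coded ascending columns: `k = prev + δ` where `prev` is the next free
column (`0` initially, `k + 1` after an entry). -/
def rdEntriesD : ℕ → ℕ → Toks → List (ℚ × ℕ) × Toks
  | 0, _, ts => ([], ts)
  | n + 1, nxt, l :: d :: ts => let k := nxt + d.toNat; let r := rdEntriesD n (k + 1) ts; (((l : ℚ), k) :: r.1, r.2)
  | _ + 1, _, _ => ([], [])

/-- Read `n` rows `m (ℓ δ)ᵐ` (delta-coded columns). -/
def rdRowsD : ℕ → Toks → List (List (ℚ × ℕ)) × Toks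
  | 0, ts => ([], ts)
  | n + 1, ts => let c := rdNat ts; let e := rdEntriesD c.1 0 c.2; let r := rdRowsD n e.2; (e.1 :: r.1, r.2)

/-- Read a Gram block `p q D nB polyⁿᴮ nR rowⁿᴿ` (basis over the block denominator `D`; rows delta-coded). -/
def rdBlockV2 (tab : Array (ℤ × ℤ)) (ts : Toks) : GramBlock × Toks :=
  let s := rdQ ts
  let d := rdDen s.2
  let cb := rdNat d.2
  let b := rdPolysD tab d.1 cb.1 cb.2
  let cr := rdNat b.2
  let r := rdRowsD cr.1 cr.2
  (⟨s.1, b.1, r.1⟩, r.2)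

/-- Read `n` Gram blocks (v2). -/
def rdBlocksV2 (tab : Array (ℤ × ℤ)) : ℕ → Toks → List GramBlock × Toks
  | 0, ts => ([], ts)
  | n + 1, ts => let b := rdBlockV2 tab ts; let r := rdBlocksV2 tab n b.2; (b.1 :: r.1, r.2)

/-- Read `n` weighted polynomials `(p poly)`: outer weight `p / D`, inner coefficients `/ D'`. -/
def rdQPolysD (tab : Array (ℤ × ℤ)) (D D' : ℚ) : ℕ → Toks → List (ℚ × QPoly) × Toks
  | 0, ts => ([], ts)
  | n + 1, p :: ts => let q := rdPolyD tab D' ts; let r := rdQPolysD tab D D' n q.2; ((((p : ℚ) / D), q.1) :: r.1, r.2)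
  | _ + 1, [] => ([], [])

/-- A slot `D n polyⁿ`. -/
def rdSlotPolys (tab : Array (ℤ × ℤ)) (ts : Toks) : List QPoly × Toks :=
  let d := rdDen ts; let c := rdNat d.2; rdPolysD tab d.1 c.1 c.2

/-- A slot `D D' n (p poly)ⁿ`. -/
def rdSlotQPolys (tab : Array (ℤ × ℤ)) (ts : Toks) : List (ℚ × QPoly) × Toks :=
  let d := rdDen ts; let d' := rdDen d.2; let c := rdNat d'.2; rdQPolysD tab d.1 d'.1 c.1 c.2

/-- A slot `D n (p word)ⁿ`. -/
def rdSlotQWords (tab : Array (ℤ × ℤ)) (ts : Toks) : List (ℚ × Word) × Toks :=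
  let d := rdDen ts; let c := rdNat d.2; rdTermsD tab d.1 c.1 c.2

/-- **Decode a whole certificate, grammar v2** (`moves := []`, `gram := []`). -/
def decodeSymCertV2 (ts : Toks) : SymCert :=
  let f := rdNat ts;        let frame := rdSites f.1 f.2
  let tab := siteTab frame.1
  let i := rdNat frame.2;   let inner := rdSites i.1 i.2
  let mu := rdQ inner.2
  let c := rdQ mu.2
  let uc := rdNat c.2
  let g := rdNat uc.2;      let gramM := rdBlocksV2 tab g.1 g.2
  let eom := rdSlotPolys tab gramM.2
  let wardP := rdSlotPolys tab eom.2
  let wardM := rdSlotPolys tab wardP.2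
  let antiH := rdSlotQPolys tab wardM.2
  let slack := rdSlotQWords tab antiH.2
  let charged := rdSlotQWords tab slack.2
  { frame := frame.1, inner := inner.1, mu := mu.1, c := c.1, gram := [], gramM := gramM.1, eom := eom.1, moves := [],
    charged := charged.1, wardP := wardP.1, wardM := wardM.1, antiH := antiH.1, slack := slack.1, useCanon := uc.1 == 1 }

/-- Number of tokens left over after a v2 decode (a well-formed data string leaves `0`). -/
def decodeRestV2 (ts : Toks) : ℕ :=
  let f := rdNat ts;        let frame := rdSites f.1 f.2
  let tab := siteTab frame.1
  let i := rdNat frame.2;   let inner := rdSites i.1 i.2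
  let mu := rdQ inner.2
  let c := rdQ mu.2
  let uc := rdNat c.2
  let g := rdNat uc.2;      let gramM := rdBlocksV2 tab g.1 g.2
  let eom := rdSlotPolys tab gramM.2
  let wardP := rdSlotPolys tab eom.2
  let wardM := rdSlotPolys tab wardP.2
  let antiH := rdSlotQPolys tab wardM.2
  let slack := rdSlotQWords tab antiH.2
  let charged := rdSlotQWords tab slack.2
  charged.2.length

/-! ### Structural Boolean equality of certificates (for the v1 = v2 round-trip test; not used by the checker) -/

/-- Lists agree elementwise under `f`. -/
def listEqB {α β : Type} (f : α → β → Bool) : List α → List β → Bool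
  | [], [] => true
  | a :: l, b :: m => f a b && listEqB f l m
  | _, _ => false

/-- Equality of polynomials: same terms in the same order, coefficients by `decide`, words by `wordEq`. -/
def polyEqB (p q : QPoly) : Bool := listEqB (fun t u => decide (t.1 = u.1) && wordEq t.2 u.2) p q

/-- Equality of Gram blocks. -/
def gramBlockEqB (A B : GramBlock) : Bool :=
  decide (A.scale = B.scale) && listEqB polyEqB A.basis B.basis &&
    listEqB (fun r s => listEqB (fun e f => decide (e.1 = f.1) && e.2 == f.2) r s) A.rows B.rows

/-- Equality of explicit moves. -/
def d4MoveEqB (a b : D4Move) : Bool := decide (a.z = b.z) && wordEq a.u b.u && decide (a.γ = b.γ) && siteEq a.v b.v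

/-- **Structural Boolean equality of two certificates** (every slot, elementwise; sites compared by `siteEq`). -/
def symCertEqB (K L : SymCert) : Bool :=
  listEqB siteEq K.frame L.frame && listEqB siteEq K.inner L.inner && decide (K.mu = L.mu) && decide (K.c = L.c) &&
    listEqB (fun g h => decide (g.1 = h.1) && polyEqB g.2 h.2) K.gram L.gram && listEqB gramBlockEqB K.gramM L.gramM &&
    listEqB polyEqB K.eom L.eom && listEqB d4MoveEqB K.moves L.moves &&
    listEqB (fun t u => decide (t.1 = u.1) && wordEq t.2 u.2) K.charged L.charged &&
    listEqB polyEqB K.wardP L.wardP && listEqB polyEqB K.wardM L.wardM &&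
    listEqB (fun t u => decide (t.1 = u.1) && polyEqB t.2 u.2) K.antiH L.antiH &&
    listEqB (fun t u => decide (t.1 = u.1) && wordEq t.2 u.2) K.slack L.slack && K.useCanon == L.useCanon

/-- Demo (compiled): the same 2-term polynomial in v1 letters `(x y s dag)` and in v2 codes against the frame
`[(0,0), (1,0)]` with denominator `40`: `40/40 · c†_{(0,0)↑} c_{(0,0)↑} − 3/40 · c†_{(1,0)↓}` — codes `1 0 7`. -/
example : polyEqB (rdPoly (toks "2  1 1 2 0 0 0 1 0 0 0 0  -3 40 1 1 0 1 1")).1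
    (rdPolyD (siteTab [mkSite 0 0, mkSite 1 0]) 40 (toks "2  40 2 1 0  -3 1 7")).1 = true := by native_decide

/-- Demo: `symCertEqB` is reflexive on T1's toy (sanity of the comparison itself). -/
example : symCertEqB toyCanonCert toyCanonCert = true := by native_decide

end DecodeV2

end Summit.Ventures.CertifiedManyBodySolver.Theorems.SymReplay
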